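import Summits.HodgeConjecture.HodgeConjecture.Theorems.SignSymmetricPowersOrbitDataExchange
import Summits.HodgeConjecture.HodgeConjecture.Theorems.SignSymmetricPowersConfluenceLinkGNSolo
import Summits.HodgeConjecture.HodgeConjecture.Theorems.SignSymmetricPowersPencilTransvectionsSolo
import Summits.HodgeConjecture.HodgeConjecture.Theorems.SignSymmetricPowersMeridianGenerationMonomial
import HarnessLib

/-!
# Crux K1-B `VeryGeneralSignCommutatorsInHg`: the GEO statement and the sign-pencil ENVELOPE with NO Picard–Lefschetz binder (registry v25; both
# PL inputs DISCHARGED: prover-Bx p680592, 20241-p1 p684662; route `SignSymmetricPowers`, stmt-HodgeConjecture-19716)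

Prover seat `hodge-nonav-19716-p2` (g10), cell `hodge-nonav`; helper `--supports stmt-HodgeConjecture-19716`; sorry-free, no definition, no
new named fact.  VERBATIM twin of `SignSymmetricPowersOrbitDataKeyed` in which the one-node binder is DELETED: GEN = `signMeridianGeneration_monomial`
(directions `x₄^d, x₀^d, x₂^d` exposed, so that the Π∕L pencils are monomial-direction instances of prover-Bx's theorem
`NodalPencil.picardLefschetz_oneNode_monomial`), PEN = `signPencilTransvections_pair`, LINK-G = `signConfluenceLinkG_of_nonComm_pair`; parities of the fixed centres from `hΓτ` by
`eq_or_eq_neg_of_oneParamTransvection_comm`; envelope by `signPencil_clauses_of_orbitData_unsigned` with both `τ`-eigenspaces of `H³` non-zero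
by `SignSymmetricPowersOrbitDataExchange.exists_signEigenvector` (Shioda's count).

* `signPencilOrbitData_solo`, `signPencilEnvelope_solo`.

CONDITIONAL on {hN} (+ ZvK, D1, MC); nothing here says HC ∕ HC_AV is proved; rung F-H1 not moved.

## References

* [VoisinHodgeII2003] C. Voisin, Hodge Theory and Complex Algebraic Geometry II, §3.2.1 Thm. 3.16, §3.2.2, §6.1.3 Cor. 6.12.
* [Deligne1980] P. Deligne, La conjecture de Weil II, §4.4 (4.4.1)–(4.4.4^α).
* [Shioda1979HodgeFermat] T. Shioda, The Hodge conjecture for Fermat varieties, Math. Ann. 245 (1979), §1.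
-/

noncomputable section

set_option linter.dupNamespace false
set_option linter.unusedVariables false
set_option maxHeartbeats 800000

namespace Summit.HodgeConjecture.HodgeConjecture.Theorems.SignSymmetricPowersOrbitDataSolo

open Finset MvPolynomial CategoryTheory
open Literature.AlgebraicGeometry.Motives Literature.AlgebraicGeometry.HodgeTheory
open Literature.AlgebraicGeometry.HodgeTheory.BettiUniverse
open Literature.AlgebraicTopology.SingularHomology
open Summit.HodgeConjecture.HodgeConjecture.Theorems.SignSymmetricPowersConfluenceLinkG (isSupportedOn_of_coeff_odd_eq_zero)
open Summit.HodgeConjecture.HodgeConjecture.Theorems.SignSymmetricPowersPencilOrbitData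
open Summit.HodgeConjecture.HodgeConjecture.Theorems.SignSymmetricPowersSevenFacts
open Summit.HodgeConjecture.HodgeConjecture.Theorems.SignSymmetricPowersFourFactsGeometricGenus
open Summit.HodgeConjecture.HodgeConjecture.Theorems.SignSymmetricPowersSignFermatCount
open Summit.HodgeConjecture.HodgeConjecture.Theorems.SignSymmetricPowersSignEigenHodgeOfGeometricGenus
open Summit.HodgeConjecture.HodgeConjecture.Theorems.SignSymmetricPowersOrbitDataExchange (exists_signEigenvector)

/-! ### §1 The GEO statement with unsigned fixed centres, from the keyed binders -/

open Literature.AlgebraicGeometry.Motives Literature.AlgebraicGeometry.Motives.UniversalHypersurface Literature.AlgebraicGeometry.HodgeTheory Literature.AlgebraicGeometry.HodgeTheory.UniversalHypersurface Literature.AlgebraicGeometry.HodgeTheory.BettiUniverse CategoryTheory.Limits in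
/-- **The GEO statement `SignPencilOrbitData` with UNSIGNED fixed centres, NO Picard–Lefschetz binder** (verbatim
`SignSymmetricPowersOrbitDataKeyed.signPencilOrbitData_keyed` with the one-node binder served by prover-Bx's theorem, the monomial witnesses
read off `signMeridianGeneration_monomial`): same witness `familyM ℂ 3 d M_ι`, same clauses, except that the parities of the two fixed
Picard–Lefschetz centres are now `τ rP = rP ∨ τ rP = -rP`, `τ rL = rL ∨ τ rL = -rL` — DERIVED, not from Wall's theorem, but from the
commutation of the transvections `U_{rP}(c₁), U_{rL}(c₂) ∈ Γ` with `τ` (`hΓτ`) by `eq_or_eq_neg_of_oneParamTransvection_comm`.  GEN is the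
PL-free `signMeridianGeneration_monomial`, PEN is `signPencilTransvections_solo`, LINK-G is `signConfluenceLinkG_of_nonComm_solo`. -/
theorem signPencilOrbitData_solo (hNC : ∀ (n d : ℕ) (f₁ g₀ g₂ : MvPolynomial (Fin (n + 2)) ℂ) (j k : Fin (n + 2)) (a : Fin (n + 2) → ℂˣ),
      1 ≤ n → 1 ≤ d → f₁.IsHomogeneous d → g₀.IsHomogeneous d → g₂.IsHomogeneous d → Literature.AlgebraicGeometry.HodgeTheory.IsSymmetricA3Datum f₁ g₀ g₂ j k a →
      ∀ (εa εb : ℝ) (ψ : ℂ → ℂ), Literature.AlgebraicGeometry.HodgeTheory.IsSymmetricA3Bifurcation f₁ g₀ g₂ j a εa εb ψ →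
        ∃ εa' : ℝ, 0 < εa' ∧ εa' ≤ εa ∧ Literature.AlgebraicGeometry.HodgeTheory.SymmetricA3NonCommutation n d f₁ g₀ g₂ ψ εa')
    (hMC : Literature.AlgebraicGeometry.FundamentalGroup.affineHypersurfaceComplement_meridian_isConj)
    (hZvK : Literature.AlgebraicGeometry.FundamentalGroup.affineHypersurfaceComplement_meridians_normalClosure_eq_top)
    (hD0 : (∀ (n d : ℕ), 2 ≤ d → ∃ Disc : MvPolynomial (Literature.AlgebraicGeometry.Motives.UniversalHypersurface.DegIndex n d) ℂ, Irreducible Disc ∧ Disc.IsHomogeneous Disc.totalDegree ∧ 0 < Disc.totalDegree ∧ ∀ a : Literature.AlgebraicGeometry.Motives.UniversalHypersurface.DegIndex n d → ℂ, a ∈ Literature.AlgebraicGeometry.HodgeTheory.singularCoeffs n d ↔ MvPolynomial.eval a Disc = 0)) (hD1 : discriminant_localBranches_nodal) (hNodal : ∀ ⦃d : ℕ⦄, Even d → 4 ≤ d → (∃ f : MvPolynomial (Fin 5) ℂ, f.IsHomogeneous d ∧ (∀ e : Fin 5 →₀ ℕ, ¬ Even (e 0 + e 1) → f.coeff e = 0)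 ∧ Literature.AlgebraicGeometry.HodgeTheory.IsNodalFormWithNodes f ![(![0, 0, 0, 0, 1] : Fin 5 → ℂ)]) ∧ (∃ f : MvPolynomial (Fin 5) ℂ, f.IsHomogeneous d ∧ (∀ e : Fin 5 →₀ ℕ, ¬ Even (e 0 + e 1) → f.coeff e = 0) ∧ Literature.AlgebraicGeometry.HodgeTheory.IsNodalFormWithNodes f ![(![1, 0, 0, 0, 0] : Fin 5 → ℂ)]) ∧ (∃ f : MvPolynomial (Fin 5) ℂ, f.IsHomogeneous d ∧ (∀ e : Fin 5 →₀ ℕ, ¬ Even (e 0 + e 1) → f.coeff e = 0) ∧ Literature.AlgebraicGeometry.HodgeTheory.IsNodalFormWithNodes f ![(![1, 0, 1, 0, 0] : Fin 5 → ℂ), ![-1, 0, 1, 0, 0]])) :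
    open Literature.AlgebraicGeometry.Motives Literature.AlgebraicGeometry.HodgeTheory Literature.AlgebraicGeometry.HodgeTheory.BettiUniverse CategoryTheory.Limits in ∀ ⦃d : ℕ⦄, Even d → 4 ≤ d → ∃ (𝒳 S : SchemeOver ℂ) (u : 𝒳 ⟶ S) (hu : IsSmoothProjectiveFamily u 3) (_ : IsQuasiProjectiveOver 𝒳) (_ : IsQuasiProjectiveOver S) (_ : AlgebraicGeometry.Smooth S.hom) (_ : IrreducibleSpace S.left) (hU : IsCohomologicallyLocallyTrivialOn u (Set.univ : Set (ComplexPoints S))) (A : ∀ t : ComplexPoints S, HodgeModel 3 (fiberOver u t)) (hA : ∀ t, (A t).IsHodgeSymmetric) (hfin : ∀ t : ComplexPoints S, Module.Finite ℚ (bettiCohomology (fiberOver u t) 3)) (pt : MvPolynomial (Fin 5) ℂ → ComplexPoints S), (∀ W : Set (ComplexPoints S), IsZariskiClosedOnPoints S W → W ≠ Set.univ → ∃ G : MvPolynomial {e : Fin 5 →₀ ℕ // e.degree = d} ℂ, (∃ f : MvPolynomial (Fin 5) ℂ, f.IsHomogeneous d ∧ (∀ e : Fin 5 →₀ ℕ,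 ¬ Even (e 0 + e 1) → f.coeff e = 0) ∧ MvPolynomial.eval (fun e : {e : Fin 5 →₀ ℕ // e.degree = d} => f.coeff e.1) G ≠ 0) ∧ ∀ f : MvPolynomial (Fin 5) ℂ, f.IsHomogeneous d → (∀ e : Fin 5 →₀ ℕ, ¬ Even (e 0 + e 1) → f.coeff e = 0) → IsSmoothProjective 3 (SmoothHypersurface.hypersurface f) → MvPolynomial.eval (fun e : {e : Fin 5 →₀ ℕ // e.degree = d} => f.coeff e.1) G ≠ 0 → pt f ∉ W) ∧ (∀ f : MvPolynomial (Fin 5) ℂ, f.IsHomogeneous d → (∀ e : Fin 5 →₀ ℕ, ¬ Even (e 0 + e 1) → f.coeff e = 0) → SmoothHypersurface.IsNonsingularForm ℂ f → ∀ (hXF : IsSmoothProjective 3 (SmoothHypersurface.hypersurface f)) (ha : (fun i : Fin 5 => if (i : ℕ) < 2 then (-1 : ℂˣ) else 1) ∈ diagonalStabilizer f), ∃ (φ : bettiCohomology (fiberOver u (pt f)) 3 ≃ₗ[ℚ] bettiCohomology (SmoothHypersurface.hypersurface f) 3) (B : LinearMap.BilinForm ℚ (bettiCohomology (fiberOver u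 (pt f)) 3)) (hB : B.IsAlt) (_ : B.Nondegenerate) (τ : bettiCohomology (fiberOver u (pt f)) 3 →ₗ[ℚ] bettiCohomology (fiberOver u (pt f)) 3) (_ : τ ^ 2 = 1) (rP rL δ₀ : bettiCohomology (fiberOver u (pt f)) 3) (c₁ c₂ c₃ : ℚ) (E : Set (bettiCohomology (fiberOver u (pt f)) 3 ≃ₗ[ℚ] bettiCohomology (fiberOver u (pt f)) 3)), let Γ := (haveI := hfin (pt f); ratMonodromyGroup u 3 hU ⟨pt f, Set.mem_univ _⟩); Nontrivial (bettiCohomology (fiberOver u (pt f)) 3) ∧ (∀ x y, B (τ x) (τ y) = B x y) ∧ (∀ x, φ (τ x) = pull (diagonalAut f ha) 3 (φ x)) ∧ (∀ x y, B x y = tr hXF (3 + 3) (cup (SmoothHypersurface.hypersurface f) 3 3 (φ x) (φ y))) ∧ (haveI : HodgeTensorFacts.{0, 0} := hodgeTensorFacts_holds; haveI := finite hXF 3; haveI := hfin (pt f); ∀ k : bettiCohomology (fiberOver u (pt f)) 3 ≃ₗ[ℚ] bettiCohomology (fiberOver u (pt f)) 3, k ∈ ((A (pt f)).hodgeStructure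 (hu.isSmoothProjective (pt f)) (hA (pt f)) 3).hodgeGroup → (φ.symm.trans k).trans φ ∈ (hodge exists_isReal_hodgeModel_holds hXF 3).hodgeGroup) ∧ (∀ g ∈ Γ, ∀ x, g (τ x) = τ (g x)) ∧ (∀ g ∈ Γ, ∀ x y, B (g x) (g y) = B x y) ∧ (τ rP = rP ∨ τ rP = -rP) ∧ (τ rL = rL ∨ τ rL = -rL) ∧ B δ₀ (τ δ₀) = 0 ∧ c₁ ≠ 0 ∧ c₂ ≠ 0 ∧ c₃ ≠ 0 ∧ oneParamTransvectionEquiv B (hB rP) c₁ ∈ Γ ∧ oneParamTransvectionEquiv B (hB rL) c₂ ∈ Γ ∧ oneParamTransvectionEquiv B (hB δ₀) c₃ * oneParamTransvectionEquiv B (hB (τ δ₀)) c₃ ∈ Γ ∧ Γ = Subgroup.closure E ∧ (∀ e ∈ E, ∃ g ∈ Γ, e = g * oneParamTransvectionEquiv B (hB rP) c₁ * g⁻¹ ∨ e = g * oneParamTransvectionEquiv B (hB rL) c₂ * g⁻¹ ∨ e = g * (oneParamTransvectionEquiv B (hB δ₀) c₃ * oneParamTransvectionEquiv B (hB (τ δ₀))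 c₃) * g⁻¹) ∧ (∀ x : bettiCohomology (fiberOver u (pt f)) 3, (∀ g ∈ Γ, g x = x) → x = 0) ∧ (∃ g ∈ Γ, B rP (g δ₀) ≠ 0) ∧ (∃ g ∈ Γ, B rL (g δ₀) ≠ 0)) := by
  classical
  intro d hd h4d
  obtain ⟨hirr, ⟨t₀⟩, hγ, A, hA, hFIBt⟩ := Summit.HodgeConjecture.HodgeConjecture.Theorems.SignSymmetricPowersFibreCoreB.stub_signFibreCoreC hd h4d
  have hu : IsSmoothProjectiveFamily (familyM ℂ 3 d {m : DegIndex 3 d | Even (m.1 0 + m.1 1)}) 3 := isSmoothProjectiveFamily_familyM ℂ 3 d {m : DegIndex 3 d | Even (m.1 0 + m.1 1)} (by decide) (le_trans (by decide) h4d)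
  refine ⟨totalM ℂ 3 d {m : DegIndex 3 d | Even (m.1 0 + m.1 1)}, baseM ℂ 3 d {m : DegIndex 3 d | Even (m.1 0 + m.1 1)}, (familyM ℂ 3 d {m : DegIndex 3 d | Even (m.1 0 + m.1 1)}), hu,
    isQuasiProjectiveOver_totalM ℂ 3 d {m : DegIndex 3 d | Even (m.1 0 + m.1 1)} (lt_of_lt_of_le (by decide) h4d), isQuasiProjectiveOver_baseM 3 d {m : DegIndex 3 d | Even (m.1 0 + m.1 1)},
    smooth_baseM_hom ℂ 3 d {m : DegIndex 3 d | Even (m.1 0 + m.1 1)}, hirr, isCohomologicallyLocallyTrivialOn_familyM 3 d {m : DegIndex 3 d | Even (m.1 0 + m.1 1)} (by decide) (le_trans (by decide) h4d), A, hA,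
    fun s => finite (hu.isSmoothProjective s) 3, classifyingPoint ℂ 3 d {m : DegIndex 3 d | Even (m.1 0 + m.1 1)} t₀, ?_, ?_⟩
  · -- ALG avoidance: landed `alg_baseM_classifyingPoint`
    intro W hW hW'
    obtain ⟨G, ⟨f, hf, hMf, hG⟩, hall⟩ := alg_baseM_classifyingPoint ℂ 3 d {m : DegIndex 3 d | Even (m.1 0 + m.1 1)} t₀ W hW hW'
    exact ⟨G, ⟨f, hf, coeff_odd_eq_zero_of_isSupportedOn hf hMf, hG⟩,
      fun f hf hev _ hG => (hall f hf (isSupportedOn_of_coeff_odd_eq_zero hev) hG).2⟩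
  · intro f hf hev hJ hXF ha
    have hMf := isSupportedOn_of_coeff_odd_eq_zero (d := d) hev
    have hY : IsSmoothProjective 3 (fiberOver (familyM ℂ 3 d {m : DegIndex 3 d | Even (m.1 0 + m.1 1)}) (classifyingPoint ℂ 3 d {m : DegIndex 3 d | Even (m.1 0 + m.1 1)} t₀ f)) := hu.isSmoothProjective _
    have hF := hFIBt hγ t₀ f hf hMf hJ
    have hF := hF hXF ha
    obtain ⟨hBn, hτ2, hτB, hΓτ, hΓB, φ, hφτ, ⟨c, hc, hφB⟩, hHG⟩ := hF
    -- no Γ-invariants: the NOINV piece at the base point (stepwise application through the `let`-telescope)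
    have hN := Summit.HodgeConjecture.HodgeConjecture.Theorems.SignSymmetricPowersNoInvariantsTorus.signNoInvariants hd h4d
    have hGIC' := hN (classifyingPoint ℂ 3 d {m : DegIndex 3 d | Even (m.1 0 + m.1 1)} t₀ f)
    obtain ⟨⟨f₁, hf₁, hev₁, hn₁⟩, ⟨f₂, hf₂, hev₂, hn₂⟩, ⟨f₃, hf₃, hev₃, hn₃⟩⟩ := hNodal hd h4d
    have hM₁ := isSupportedOn_of_coeff_odd_eq_zero (d := d) hev₁
    have hM₂ := isSupportedOn_of_coeff_odd_eq_zero (d := d) hev₂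
    have hM₃ := isSupportedOn_of_coeff_odd_eq_zero (d := d) hev₃
    -- (piece applications are made stepwise: one-shot elaboration of the long `let`-telescopes times out)
    have hG := Summit.HodgeConjecture.HodgeConjecture.Theorems.SignSymmetricPowersMeridianGenerationMonomial.signMeridianGeneration_monomial hZvK hD0 hD1 hd h4d
    have hG := hG hγ t₀ f hf hMf hJ
    have hG := hG f₁ f₂ f₃
    have hG := hG hf₁ hM₁ hn₁
    have hG := hG hf₂ hM₂ hn₂
    have hG := hG hf₃ hM₃ hn₃
    obtain ⟨g₁, g₂, g₃, hg₁X, hg₂X, hg₃X, hg₁, hMg₁, hgp₁, hg₂, hMg₂, hgp₂, hg₃, hMg₃, hgp₃, ε₁, hε₁, hGENε⟩ := hG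
    have hg₁m : ∃ (i : Fin 5) (a : ℂ), g₁ = a • MvPolynomial.X i ^ d := ⟨4, 1, by rw [hg₁X, one_smul]⟩
    have hg₂m : ∃ (i : Fin 5) (a : ℂ), g₂ = a • MvPolynomial.X i ^ d := ⟨0, 1, by rw [hg₂X, one_smul]⟩
    have hg₃m : ∃ (i : Fin 5) (a : ℂ), g₃ = a • MvPolynomial.X i ^ d := ⟨2, 1, by rw [hg₃X, one_smul]⟩
    have hP := Summit.HodgeConjecture.HodgeConjecture.Theorems.SignSymmetricPowersPencilTransvectionsSolo.signPencilTransvections_solo hd h4d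
    have hP := hP hγ t₀ f hf hMf hJ
    obtain ⟨hPP, hPN, hP2⟩ := hP
    have hPP := hPP f₁ g₁ hf₁ hg₁ hg₁m
    have hPP := hPP hM₁ hMg₁ hn₁ hgp₁
    obtain ⟨εP, hεP, hPPε⟩ := hPP
    have hPN := hPN f₂ g₂ hf₂ hg₂ hg₂m
    have hPN := hPN hM₂ hMg₂ hn₂ hgp₂
    obtain ⟨εL, hεL, hPLε⟩ := hPN
    have hP2 := hP2 f₃ g₃ hf₃ hg₃ hg₃m
    have hP2 := hP2 hM₃ hMg₃ hn₃ hgp₃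
    obtain ⟨εD, hεD, hP2ε⟩ := hP2
    have hK := (Summit.HodgeConjecture.HodgeConjecture.Theorems.SignSymmetricPowersConfluenceLinkGNSolo.signConfluenceLinkG_of_nonComm_solo hD0 hNC
      hMC hD1) hd h4d
    have hK := hK hγ t₀ f hf hMf hJ
    have hK := hK hτ2 hτB hΓτ hΓB
    have hK₁ := hK ![0, 0, 0, 0, 1] (Or.inl rfl) f₁ g₁ hf₁ hg₁
    have hK₁ := hK₁ hM₁ hMg₁ hn₁ hgp₁ f₃ g₃ hf₃ hg₃
    have hK₁ := hK₁ hM₃ hMg₃ hn₃ hgp₃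
    obtain ⟨εK, hεK, hKε⟩ := hK₁
    have hK₂ := hK ![1, 0, 0, 0, 0] (Or.inr rfl) f₂ g₂ hf₂ hg₂
    have hK₂ := hK₂ hM₂ hMg₂ hn₂ hgp₂ f₃ g₃ hf₃ hg₃
    have hK₂ := hK₂ hM₃ hMg₃ hn₃ hgp₃
    obtain ⟨εK', hεK', hK'ε⟩ := hK₂
    -- a common radius below the six bounds
    have hm : 0 < min (min (min ε₁ εP) (min εL εD)) (min εK εK') :=
      lt_min (lt_min (lt_min hε₁ hεP) (lt_min hεL hεD)) (lt_min hεK hεK')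
    have hε : 0 < min (min (min ε₁ εP) (min εL εD)) (min εK εK') / 2 := half_pos hm
    have hεm : min (min (min ε₁ εP) (min εL εD)) (min εK εK') / 2 < min (min (min ε₁ εP) (min εL εD)) (min εK εK') :=
      half_lt_self hm
    have h₁ := hεm.trans_le ((min_le_left _ _).trans ((min_le_left _ _).trans (min_le_left _ _)))
    have h₂ := hεm.trans_le ((min_le_left _ _).trans ((min_le_left _ _).trans (min_le_right _ _)))
    have h₃ := hεm.trans_le ((min_le_left _ _).trans ((min_le_right _ _).trans (min_le_left _ _)))
    have h₄ := hεm.trans_le ((min_le_left _ _).trans ((min_le_right _ _).trans (min_le_right _ _)))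
    have h₅ := hεm.trans_le ((min_le_right _ _).trans (min_le_left _ _))
    have h₆ := hεm.trans_le ((min_le_right _ _).trans (min_le_right _ _))
    have hGENε := hGENε _ hε h₁
    obtain ⟨s₁, s₂, s₃, β₁, β₂, β₃, ω₁, ω₂, ω₃, T₁, T₂, T₃, E, hs₁, hω₁, hs₂, hω₂, hs₃, hω₃, hT₁, hT₂, hT₃, hΓE, hE⟩ := hGENε
    have hPPε := hPPε _ hε h₂ s₁ β₁ ω₁
    have hPPε := hPPε hs₁ hω₁ T₁ hT₁
    obtain ⟨rP, c₁, hrP0, hc₁, hT₁eq⟩ := hPPε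
    -- parity of the Π-centre from `U_{rP}(c₁) ∈ Γ` commuting with `τ` (no Wall sign rule)
    have hτrP := eq_or_eq_neg_of_oneParamTransvection_comm hBn hτ2 hc₁ (r := rP) fun x => by
      simpa only [hT₁eq, oneParamTransvectionEquiv_apply, oneParamTransvection_apply] using hΓτ T₁ ⟨_, hT₁⟩ x
    have hPLε := hPLε _ hε h₃ s₂ β₂ ω₂
    have hPLε := hPLε hs₂ hω₂ T₂ hT₂
    obtain ⟨rL, c₂, hrL0, hc₂, hT₂eq⟩ := hPLε
    -- parity of the L-centre likewise
    have hτrL := eq_or_eq_neg_of_oneParamTransvection_comm hBn hτ2 hc₂ (r := rL) fun x => by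
      simpa only [hT₂eq, oneParamTransvectionEquiv_apply, oneParamTransvection_apply] using hΓτ T₂ ⟨_, hT₂⟩ x
    have hP2ε := hP2ε _ hε h₄ s₃ β₃ ω₃
    have hP2ε := hP2ε hs₃ hω₃ T₃ hT₃
    obtain ⟨δ₀, c₃, hδ0, hδ0', hc₃, hBδτ, hT₃eq⟩ := hP2ε
    have hKε := hKε _ _ hε h₅ hε h₅ s₁ β₁ ω₁
    have hKε := hKε hs₁ hω₁ s₃ β₃ ω₃
    have hKε := hKε hs₃ hω₃ T₁ hT₁ T₃ hT₃
    have hKε := hKε rP δ₀ c₁ c₃ hrP0 hδ0 hδ0' hτrP hBδτ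
    have hKε := hKε hT₁eq hT₃eq
    obtain ⟨gP, hgP, hlinkP⟩ := hKε
    have hK'ε := hK'ε _ _ hε h₆ hε h₆ s₂ β₂ ω₂
    have hK'ε := hK'ε hs₂ hω₂ s₃ β₃ ω₃
    have hK'ε := hK'ε hs₃ hω₃ T₂ hT₂ T₃ hT₃
    have hK'ε := hK'ε rL δ₀ c₂ c₃ hrL0 hδ0 hδ0' hτrL hBδτ
    have hK'ε := hK'ε hT₂eq hT₃eq
    obtain ⟨gL, hgL, hlinkL⟩ := hK'ε
    subst hT₁eq hT₂eq hT₃eq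
    -- v12d seam (FIB-coreC: `B = c · φ^*B_{X_f}`, `c ≠ 0` opaque): GEO's form is `c⁻¹ • B`, the transvection parameters become `cᵢ * c`
    have e₁ := oneParamTransvectionEquiv_inv_smul _ hrP0 hc c₁
    have e₂ := oneParamTransvectionEquiv_inv_smul _ hrL0 hc c₂
    have e₃ := oneParamTransvectionEquiv_inv_smul _ hδ0 hc c₃
    have e₃' := oneParamTransvectionEquiv_inv_smul _ hδ0' hc c₃
    simp only [← e₁, ← e₂, ← e₃, ← e₃'] at hT₁ hT₂ hT₃ hE
    refine ⟨φ, _, isAlt_smul_form (isAlt_tr_cup_of_odd hY ⟨1, by norm_num⟩) c⁻¹, nondegenerate_smul_form hBn (inv_ne_zero hc), _, hτ2,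
      rP, rL, δ₀, c₁ * c, c₂ * c, c₃ * c, E, ?_⟩
    intro Γ
    -- `H³ ≠ 0`: LINK gives `B rP (gP δ₀) ≠ 0`, so `rP ≠ 0`
    have hNon : Nontrivial (bettiCohomology (fiberOver (familyM ℂ 3 d {m : DegIndex 3 d | Even (m.1 0 + m.1 1)}) (classifyingPoint ℂ 3 d {m : DegIndex 3 d | Even (m.1 0 + m.1 1)} t₀ f)) 3) :=
      nontrivial_of_ne rP 0 fun h0 => hlinkP (by simp only [h0, map_zero, LinearMap.zero_apply])
    exact ⟨hNon, smul_form_invariant hτB c⁻¹, hφτ, inv_smul_form_eq hc hφB, hHG, hΓτ, smul_form_invariant_subgroup hΓB c⁻¹, hτrP, hτrL,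
      smul_form_apply_eq_zero hBδτ c⁻¹, mul_ne_zero hc₁ hc, mul_ne_zero hc₂ hc, mul_ne_zero hc₃ hc, ⟨_, hT₁⟩, ⟨_, hT₂⟩, ⟨_, hT₃⟩, hΓE, hE,
      hGIC', ⟨gP, hgP, inv_smul_form_apply_ne_zero hlinkP hc⟩, ⟨gL, hgL, inv_smul_form_apply_ne_zero hlinkL hc⟩⟩


/-! ### §2 The envelope with fixed centres of unknown sign, from the keyed binders -/

/-- **The sign-pencil ENVELOPE with fixed centres of UNKNOWN sign, NO Picard–Lefschetz binder** (verbatim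
`SignSymmetricPowersOrbitDataKeyed.signPencilEnvelope_keyed`): the orbit data of `signPencilOrbitData_solo` assembled by
`signPencil_clauses_of_orbitData_unsigned` (W-ELIM brick 3b) instead of `stub_signOrbitData` — output = the hypothesis list of
`commutator_mem_hodgeGroup_of_signSymmetric_of_eigenCentres`: `hT`, `hD`, eigen-centres `τ r = ±r`, a fixed seed whenever there are pairs,
`span R_± = V_±`, orthogonal connectedness of `R_±`.  The extra input of the unsigned assembly — both eigenspaces of `τ` on `H³` are
non-zero — is `exists_signEigenvector` (Shioda's count on `X_f`) transported along `φ`. -/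
theorem signPencilEnvelope_solo (hZvK : Literature.AlgebraicGeometry.FundamentalGroup.affineHypersurfaceComplement_meridians_normalClosure_eq_top)
    (hD1 : Literature.AlgebraicGeometry.HodgeTheory.discriminant_localBranches_nodal) (hNC : ∀ (n d : ℕ) (f₁ g₀ g₂ : MvPolynomial (Fin (n + 2)) ℂ) (j k : Fin (n + 2)) (a : Fin (n + 2) → ℂˣ),
      1 ≤ n → 1 ≤ d → f₁.IsHomogeneous d → g₀.IsHomogeneous d → g₂.IsHomogeneous d → Literature.AlgebraicGeometry.HodgeTheory.IsSymmetricA3Datum f₁ g₀ g₂ j k a →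
      ∀ (εa εb : ℝ) (ψ : ℂ → ℂ), Literature.AlgebraicGeometry.HodgeTheory.IsSymmetricA3Bifurcation f₁ g₀ g₂ j a εa εb ψ →
        ∃ εa' : ℝ, 0 < εa' ∧ εa' ≤ εa ∧ Literature.AlgebraicGeometry.HodgeTheory.SymmetricA3NonCommutation n d f₁ g₀ g₂ ψ εa')
    (hMC : Literature.AlgebraicGeometry.FundamentalGroup.affineHypersurfaceComplement_meridian_isConj) :
    open Literature.AlgebraicGeometry.Motives Literature.AlgebraicGeometry.HodgeTheory Literature.AlgebraicGeometry.HodgeTheory.BettiUniverse CategoryTheory.Limits in ∀ ⦃d : ℕ⦄, Even d → 4 ≤ d → ∃ (𝒳 S : SchemeOver ℂ) (u : 𝒳 ⟶ S) (hu : IsSmoothProjectiveFamily u 3) (_ : IsQuasiProjectiveOver 𝒳) (_ : IsQuasiProjectiveOver S) (_ : AlgebraicGeometry.Smooth S.hom) (_ : IrreducibleSpace S.left) (hU : IsCohomologicallyLocallyTrivialOn u (Set.univ : Set (ComplexPoints S))) (A : ∀ t : ComplexPoints S, HodgeModel 3 (fiberOver u t)) (hA : ∀ t, (A t).IsHodgeSymmetric)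 (hfin : ∀ t : ComplexPoints S, Module.Finite ℚ (bettiCohomology (fiberOver u t) 3)) (pt : MvPolynomial (Fin 5) ℂ → ComplexPoints S), (∀ W : Set (ComplexPoints S), IsZariskiClosedOnPoints S W → W ≠ Set.univ → ∃ G : MvPolynomial {e : Fin 5 →₀ ℕ // e.degree = d} ℂ, (∃ f : MvPolynomial (Fin 5) ℂ, f.IsHomogeneous d ∧ (∀ e : Fin 5 →₀ ℕ, ¬ Even (e 0 + e 1) → f.coeff e = 0) ∧ MvPolynomial.eval (fun e : {e : Fin 5 →₀ ℕ // e.degree = d} => f.coeff e.1) G ≠ 0) ∧ ∀ f : MvPolynomial (Fin 5) ℂ, f.IsHomogeneous d → (∀ e : Fin 5 →₀ ℕ, ¬ Even (e 0 + e 1) → f.coeff e = 0) → IsSmoothProjective 3 (SmoothHypersurface.hypersurface f) → MvPolynomial.eval (fun e : {e : Fin 5 →₀ ℕ // e.degree = d} => f.coeff e.1) G ≠ 0 → pt f ∉ W) ∧ (∀ f : MvPolynomial (Fin 5) ℂ, f.IsHomogeneous d → (∀ e : Fin 5 →₀ ℕ, ¬ Even (e 0 + e 1) → f.coeff e = 0)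 → SmoothHypersurface.IsNonsingularForm ℂ f → ∀ (hXF : IsSmoothProjective 3 (SmoothHypersurface.hypersurface f)) (ha : (fun i : Fin 5 => if (i : ℕ) < 2 then (-1 : ℂˣ) else 1) ∈ diagonalStabilizer f), ∃ (φ : bettiCohomology (fiberOver u (pt f)) 3 ≃ₗ[ℚ] bettiCohomology (SmoothHypersurface.hypersurface f) 3) (B : LinearMap.BilinForm ℚ (bettiCohomology (fiberOver u (pt f)) 3)) (hB : B.IsAlt) (_ : B.Nondegenerate) (τ : bettiCohomology (fiberOver u (pt f)) 3 →ₗ[ℚ] bettiCohomology (fiberOver u (pt f)) 3) (_ : τ ^ 2 = 1) (T D : Set (bettiCohomology (fiberOver u (pt f)) 3)), let Γ := (haveI := hfin (pt f); ratMonodromyGroup u 3 hU ⟨pt f, Set.mem_univ _⟩); let RP : Set (bettiCohomology (fiberOver u (pt f)) 3) := {r ∈ T | τ r = r} ∪ (fun δ => δ + τ δ) '' D; let RN : Set (bettiCohomology (fiberOver u (pt f)) 3) := {r ∈ T | τ r = -r} ∪ (fun δ => δ - τ δ) '' D; Nontrivial (bettiCohomology (fiberOver u (pt f)) 3) ∧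 (∀ x y, B (τ x) (τ y) = B x y) ∧ (∀ x, φ (τ x) = pull (diagonalAut f ha) 3 (φ x)) ∧ (∀ x y, B x y = tr hXF (3 + 3) (cup (SmoothHypersurface.hypersurface f) 3 3 (φ x) (φ y))) ∧ (haveI : HodgeTensorFacts.{0, 0} := hodgeTensorFacts_holds; haveI := finite hXF 3; haveI := hfin (pt f); ∀ k : bettiCohomology (fiberOver u (pt f)) 3 ≃ₗ[ℚ] bettiCohomology (fiberOver u (pt f)) 3, k ∈ ((A (pt f)).hodgeStructure (hu.isSmoothProjective (pt f)) (hA (pt f)) 3).hodgeGroup → (φ.symm.trans k).trans φ ∈ (hodge exists_isReal_hodgeModel_holds hXF 3).hodgeGroup) ∧ (∀ r ∈ T, ∃ c : ℚ, c ≠ 0 ∧ oneParamTransvectionEquiv B (hB r) c ∈ Γ) ∧ (∀ δ ∈ D, B δ (τ δ) = 0 ∧ ∃ c : ℚ, c ≠ 0 ∧ oneParamTransvectionEquiv B (hB δ) c * oneParamTransvectionEquiv B (hB (τ δ)) c ∈ Γ) ∧ (∀ r ∈ T, τ r = r ∨ τ r = -r) ∧ (D.Nonempty → T.Nonempty) ∧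 Submodule.span ℚ RP = Module.End.eigenspace τ 1 ∧ (∀ A' ⊆ RP, A'.Nonempty → A' ≠ RP → ∃ r ∈ A', ∃ ρ ∈ RP, ρ ∉ A' ∧ B r ρ ≠ 0) ∧ Submodule.span ℚ RN = Module.End.eigenspace τ (-1) ∧ (∀ A' ⊆ RN, A'.Nonempty → A' ≠ RN → ∃ r ∈ A', ∃ ρ ∈ RN, ρ ∉ A' ∧ B r ρ ≠ 0)) := by
  intro d hd h4d
  obtain ⟨𝒳, S, u, hu, h𝒳, hqp, hsm, hirr, hU, A, hA, hfin, pt, hALG, hMEM⟩ := (signPencilOrbitData_solo hNC hMC hZvK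
      (fun n d hd => Literature.AlgebraicGeometry.HodgeTheory.exists_irreducible_isHomogeneous_discriminantForm (n := n) (d := d) hd) hD1
      Summit.HodgeConjecture.HodgeConjecture.Theorems.SignSymmetricPowersNodalForms.stub_signNodalForms) hd h4d
  refine ⟨𝒳, S, u, hu, h𝒳, hqp, hsm, hirr, hU, A, hA, hfin, pt, hALG, ?_⟩
  intro f hf hev hJ hXF ha
  obtain ⟨φ, B, hB, hBn, τ, hτ, rP, rL, δ₀, c₁, c₂, c₃, E, hNon, hτB, hφτ, hφB, hHG, hΓτ, hΓB, hrP, hrL, hδ₀,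
    hc₁, hc₂, hc₃, huP, huL, huδ, hΓE, hE, hinv, hlinkP, hlinkL⟩ := hMEM f hf hev hJ hXF ha
  haveI := hfin (pt f)
  -- both eigenspaces of `τ` are non-zero: Shioda's count on `X_f` (`exists_signEigenvector`), transported along `φ`
  have heig : ∀ j : ℕ, j < 2 → ∃ v : bettiCohomology (fiberOver u (pt f)) 3, v ≠ 0 ∧ τ v = ((-1 : ℚ) ^ j) • v := by
    intro j hj
    obtain ⟨y, hy0, hy⟩ := exists_signEigenvector hd h4d f hf hJ hXF ha hj
    refine ⟨φ.symm y, fun h0 => hy0 (by simpa using congrArg φ h0), φ.injective ?_⟩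
    rw [hφτ, LinearEquiv.apply_symm_apply, map_smul, LinearEquiv.apply_symm_apply]
    -- `ha` is stated for the literal sign vector; `signInvolutionVector` unfolds to it
    exact hy
  have hVpos : ∃ v : bettiCohomology (fiberOver u (pt f)) 3, v ≠ 0 ∧ τ v = v := by
    obtain ⟨v, hv0, hv⟩ := heig 0 (by norm_num)
    exact ⟨v, hv0, by rw [hv, pow_zero, one_smul]⟩
  have hVneg : ∃ v : bettiCohomology (fiberOver u (pt f)) 3, v ≠ 0 ∧ τ v = -v := by
    obtain ⟨v, hv0, hv⟩ := heig 1 (by norm_num)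
    exact ⟨v, hv0, by rw [hv, pow_one, neg_one_smul]⟩
  obtain ⟨h6, h7, h8, h9, h10, h11, h12, h13⟩ :=
    signPencil_clauses_of_orbitData_unsigned hB hBn (by norm_num) hτ hτB hΓτ hΓB hrP hrL hδ₀ hc₁ hc₂ hc₃ huP huL huδ hΓE hE
      hinv hlinkP hlinkL hVpos hVneg
  exact ⟨φ, B, hB, hBn, τ, hτ, _, _, hNon, hτB, hφτ, hφB, hHG, h6, h7, h8, h9, h10, h11, h12, h13⟩


end Summit.HodgeConjecture.HodgeConjecture.Theorems.SignSymmetricPowersOrbitDataSolo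

end
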